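import Literature.Analysis.FluidPDE.SpaceTimeParametricIntegral
import Literature.Analysis.FluidPDE.SpaceTimeCalculusC1
import Literature.Analysis.FluidPDE.VectorCalculus
import HarnessLib

/-!
# Space–time calculus at finite order of differentiability, up to the boundary of the time set

Analysis/FluidPDE support file. The tree's space–time calculus for classical solutions
(`ClassicalSolutionCalculus`, `SpaceTimeParametricIntegral`, `TaoEnstrophyLocalisation`) is
written for fields `w` **jointly `C^∞`** within `S ×ˢ univ` (`IsSmoothSpaceTimeOn S w`). The
energy-method construction of Euler flows in the periodic cylinder
(`Literature.Analysis.FluidPDE.KatoLai1984_periodicCylinderUniformExistence`) produces, at each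
Sobolev level, velocity representatives that are jointly `C^n` for a finite `n` only (the order
grows with the level), and assembles `C^∞` regularity order by order. This file supplies the
finite-order versions of the calculus, with the same proofs:

* `contDiffOn_timeDerivWithin_nat` — the time derivative within `S` of a field jointly `C^{n+1}`
  within `S ×ˢ univ` (`S` of unique differentiability) is jointly `C^n` (the pointwise `C¹`
  statements are `SpaceTimeCalculusC1`'s `timeDerivWithin_eq_fderivWithin_of_contDiffOn`,
  `hasDerivWithinAt_timeLine_of_contDiffOn`, `fderiv_slice_eq_of_contDiffOn`);
* `contDiffOn_fderiv_slice_nat`, `differentiableAt_slice_nat`, `contDiffOn_convect_nat` — the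
  slice derivatives and the convective derivative lose one order;
* `contDiffOn_parametric_intervalIntegral_prod_nat` — `p ↦ ∫ σ in a..b, H (σ, p)` is `C^n` within
  `S ×ˢ univ` for `H` of class `C^n` within `univ ×ˢ (S ×ˢ univ)`, `S ⊆ ℝ` convex with non-empty
  interior (Evans, App. C; Hörmander, Thm. 1.1.9, endpoints included as in
  `contDiffOn_parametric_intervalIntegral_prod`);
* `contDiffOn_segmentIntegral_nat` — the segment (Poincaré) potential
  `(t, x) ↦ ∫₀¹ ⟪G(t, σ x), x⟫ dσ` of a field jointly `C^n` on `S × E` is jointly `C^n`.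

Everything is proved; no named fact and no `sorry` is introduced.

## References

* L. C. Evans, *Partial Differential Equations*, 2nd ed. (2010), App. C.
* L. Hörmander, *The Analysis of Linear Partial Differential Operators I*, 2nd ed. (1990),
  Thm. 1.1.7–1.1.9.
-/

noncomputable section

open MeasureTheory Set Filter Function intervalIntegral
open _root_.Topology
open scoped ContDiff RealInnerProductSpace

namespace Literature.Analysis.FluidPDE

/-! ### Time and slice derivatives at finite order -/

section SpaceTime

variable {X : Type*} [NormedAddCommGroup X] [NormedSpace ℝ X]
variable {F : Type*} [NormedAddCommGroup F] [NormedSpace ℝ F]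
variable {S : Set ℝ} {w : ℝ → X → F} {t : ℝ} {n : ℕ}

/-- A field jointly `C^{n+1}` within `S ×ˢ univ` is jointly `C¹` there. [folklore] -/
theorem contDiffOn_one_of_succ (h : ContDiffOn ℝ (n + 1) (uncurry w) (S ×ˢ univ)) :
    ContDiffOn ℝ 1 (uncurry w) (S ×ˢ univ) :=
  h.of_le (by exact_mod_cast Nat.le_add_left 1 n)

/-- **The time derivative is jointly `C^n`** for a field jointly `C^{n+1}` within `S ×ˢ univ`,
`S` of unique differentiability. [folklore] -/
theorem contDiffOn_timeDerivWithin_nat (h : ContDiffOn ℝ (n + 1) (uncurry w) (S ×ˢ univ)) (hS : UniqueDiffOn ℝ S) :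
    ContDiffOn ℝ n (uncurry (timeDerivWithin S w)) (S ×ˢ univ) := by
  have hD : UniqueDiffOn ℝ (S ×ˢ (univ : Set X)) := hS.prod uniqueDiffOn_univ
  have hc : ContDiffOn ℝ n (fun z : ℝ × X => fderivWithin ℝ (uncurry w) (S ×ˢ univ) z ((1 : ℝ), (0 : X))) (S ×ˢ univ) :=
    (h.fderivWithin hD le_rfl).clm_apply contDiffOn_const
  refine hc.congr fun z hz => ?_
  obtain ⟨t, x⟩ := z
  exact timeDerivWithin_eq_fderivWithin_of_contDiffOn (contDiffOn_one_of_succ h) hS hz.1 x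

/-- The slices of a field jointly `C^{n+1}` within `S ×ˢ univ` are differentiable. [folklore] -/
theorem differentiableAt_slice_nat (h : ContDiffOn ℝ (n + 1) (uncurry w) (S ×ˢ univ)) (ht : t ∈ S) (x : X) :
    DifferentiableAt ℝ (w t) x :=
  (hasFDerivAt_slice_of_hasFDerivWithinAt (hasFDerivWithinAt_uncurry_of_contDiffOn (contDiffOn_one_of_succ h) ht x) ht).differentiableAt

/-- **The slice derivatives are jointly `C^n`** for a field jointly `C^{n+1}` within `S ×ˢ univ`,
`S` of unique differentiability. [folklore] -/
theorem contDiffOn_fderiv_slice_nat (h : ContDiffOn ℝ (n + 1) (uncurry w) (S ×ˢ univ)) (hS : UniqueDiffOn ℝ S) :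
    ContDiffOn ℝ n (uncurry fun t x => fderiv ℝ (w t) x) (S ×ˢ univ) := by
  have hU : UniqueDiffOn ℝ (S ×ˢ (univ : Set X)) := hS.prod uniqueDiffOn_univ
  have hc : ContDiffOn ℝ n
      (fun q : ℝ × X => (fderivWithin ℝ (uncurry w) (S ×ˢ univ) q).comp (ContinuousLinearMap.inr ℝ ℝ X)) (S ×ˢ univ) :=
    (h.fderivWithin hU le_rfl).clm_comp contDiffOn_const
  refine hc.congr ?_
  rintro ⟨t, x⟩ ⟨ht, -⟩
  exact fderiv_slice_eq_of_contDiffOn (contDiffOn_one_of_succ h) ht x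

variable {E : Type*} [NormedAddCommGroup E] [InnerProductSpace ℝ E]
variable {F' : Type*} [NormedAddCommGroup F'] [InnerProductSpace ℝ F']

/-- **The convective derivative `(u·∇)v` loses one order**: `u` jointly `C^n` and `v` jointly
`C^{n+1}` within `S ×ˢ univ` give `(u·∇)v` jointly `C^n`. [folklore] -/
theorem contDiffOn_convect_nat {u : ℝ → E → E} {v : ℝ → E → F'} (hu : ContDiffOn ℝ n (uncurry u) (S ×ˢ univ))
    (hv : ContDiffOn ℝ (n + 1) (uncurry v) (S ×ˢ univ)) (hS : UniqueDiffOn ℝ S) :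
    ContDiffOn ℝ n (uncurry fun t x => convect (u t) (v t) x) (S ×ˢ univ) :=
  (contDiffOn_fderiv_slice_nat hv hS).clm_apply hu

end SpaceTime

/-! ### Parametric integrals at finite order, up to the boundary of the time set -/

section Prod

variable {X : Type*} [NormedAddCommGroup X] [NormedSpace ℝ X] [FiniteDimensional ℝ X]
variable {F : Type*} [NormedAddCommGroup F] [NormedSpace ℝ F]

/-- **Differentiability of finite order of parametric integrals, up to the boundary of the time
set**: for `S ⊆ ℝ` convex with non-empty interior and `H` of class `C^n` within
`univ ×ˢ (S ×ˢ univ)`, the parametric integral `p ↦ ∫ σ in a..b, H (σ, p)` is `C^n` within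
`S ×ˢ univ` (Evans, App. C; Hörmander, Thm. 1.1.9; induction on `n` through Mathlib's
`contDiffOn_succ_iff_fderiv_apply`, each directional within-derivative being the parametric
integral of `(σ, p) ↦ D H (σ, p) (0, v)` by `hasFDerivWithinAt_parametric_intervalIntegral_prod`). [folklore] -/
theorem contDiffOn_parametric_intervalIntegral_prod_nat {S : Set ℝ} (hc : Convex ℝ S)
    (hi : (interior S).Nonempty) (a b : ℝ) :
    ∀ (n : ℕ) {H : ℝ × (ℝ × X) → F}, ContDiffOn ℝ n H (univ ×ˢ (S ×ˢ univ)) →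
      ContDiffOn ℝ n (fun p => ∫ σ in a..b, H (σ, p)) (S ×ˢ (univ : Set X))
  | 0, H, hH => by
    rw [Nat.cast_zero, contDiffOn_zero] at hH ⊢
    exact continuousOn_parametric_intervalIntegral hH a b
  | n + 1, H, hH => by
    have hSU : UniqueDiffOn ℝ S := uniqueDiffOn_convex hc hi
    have hD : UniqueDiffOn ℝ (S ×ˢ (univ : Set X)) := hSU.prod uniqueDiffOn_univ
    have hU : UniqueDiffOn ℝ (univ ×ˢ (S ×ˢ (univ : Set X))) :=
      (uniqueDiffOn_univ : UniqueDiffOn ℝ (univ : Set ℝ)).prod hD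
    have hne : (((n + 1 : ℕ) : ℕ∞) : WithTop ℕ∞) ≠ 0 := by simp
    rw [Nat.cast_succ, contDiffOn_succ_iff_fderiv_apply hD]
    refine ⟨fun p hp => (hasFDerivWithinAt_parametric_intervalIntegral_prod hc hi hH
      (by exact_mod_cast hne) a b hp).differentiableWithinAt, fun h => ?_, fun v => ?_⟩
    · exact absurd h (by exact_mod_cast WithTop.coe_ne_top)
    · have hH₁c := continuousOn_fderivWithin_comp_inr hH (by exact_mod_cast hne) hD
      have hv : ∀ p ∈ S ×ˢ (univ : Set X),
          fderivWithin ℝ (fun p => ∫ σ in a..b, H (σ, p)) (S ×ˢ univ) p v =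
            ∫ σ in a..b, fderivWithin ℝ H (univ ×ˢ (S ×ˢ univ)) (σ, p) ((0 : ℝ), v) := by
        intro p hp
        have hint : IntervalIntegrable (fun σ : ℝ =>
            (fderivWithin ℝ H (univ ×ˢ (S ×ˢ univ)) (σ, p)).comp
              (ContinuousLinearMap.inr ℝ ℝ (ℝ × X))) volume a b :=
          (hH₁c.comp_continuous (continuous_id.prodMk continuous_const)
            fun σ => ⟨mem_univ _, hp⟩).intervalIntegrable _ _
        rw [(hasFDerivWithinAt_parametric_intervalIntegral_prod hc hi hH (by exact_mod_cast hne) a b hp).fderivWithin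
          (hD p hp), ContinuousLinearMap.intervalIntegral_apply hint]
        rfl
      refine (contDiffOn_parametric_intervalIntegral_prod_nat hc hi a b n
        (H := fun q => fderivWithin ℝ H (univ ×ˢ (S ×ˢ univ)) q ((0 : ℝ), v)) ?_).congr hv
      exact (hH.fderivWithin hU le_rfl).clm_apply contDiffOn_const

end Prod

/-! ### The segment potential at finite order -/

section Segment

variable {E : Type*} [NormedAddCommGroup E] [InnerProductSpace ℝ E] [FiniteDimensional ℝ E]

/-- **Joint `C^n` regularity of the segment potential, up to the boundary of the time set.** If
`G` is jointly `C^n` on `S × E` for a convex time set `S` of unique differentiability (any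
non-degenerate interval), then so is `(t, x) ↦ ∫₀¹ ⟪G(t, σ x), x⟫ dσ`. [folklore] -/
theorem contDiffOn_segmentIntegral_nat {S : Set ℝ} (hc : Convex ℝ S) (hS : UniqueDiffOn ℝ S) (n : ℕ)
    {G : ℝ → E → E} (hG : ContDiffOn ℝ n (uncurry G) (S ×ˢ univ)) :
    ContDiffOn ℝ n (uncurry fun t x => ∫ σ in (0 : ℝ)..1, ⟪G t (σ • x), x⟫) (S ×ˢ univ) := by
  intro z hz
  have hi : (interior S).Nonempty := interior_nonempty_of_convex_of_uniqueDiffWithinAt hc hz.1 (hS z.1 hz.1)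
  set H : ℝ × (ℝ × E) → ℝ := fun r => ⟪G r.2.1 (r.1 • r.2.2), r.2.2⟫ with hH
  have hA : ContDiff ℝ n fun r : ℝ × (ℝ × E) => ((r.2.1, r.1 • r.2.2) : ℝ × E) :=
    (contDiff_fst.comp contDiff_snd).prodMk (contDiff_fst.smul (contDiff_snd.comp contDiff_snd))
  have hGA : ContDiffOn ℝ n (uncurry G ∘ fun r : ℝ × (ℝ × E) => ((r.2.1, r.1 • r.2.2) : ℝ × E)) (univ ×ˢ (S ×ˢ univ)) :=
    hG.comp hA.contDiffOn fun r hr => ⟨hr.2.1, mem_univ _⟩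
  have hHs : ContDiffOn ℝ n H (univ ×ˢ (S ×ˢ univ)) := hGA.inner ℝ (contDiff_snd.comp contDiff_snd).contDiffOn
  exact contDiffOn_parametric_intervalIntegral_prod_nat hc hi 0 1 n hHs z hz

end Segment

end Literature.Analysis.FluidPDE
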